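import Summits.Langlands.Langlands.Theorems.PicardMuOrdinaryMuOrdinaryFamilyRTThorneDefs
import Summits.Langlands.Langlands.Theorems.PicardMuOrdinaryMuOrdinaryFamilyRTPointAbsIrr
import Summits.Langlands.Langlands.Theorems.PicardMuOrdinaryMuOrdinaryFamilyRTPointDescentPrelim
import Literature.NumberTheory.GaloisRepresentations.AbsIrreducibleIndexTwo
import Literature.NumberTheory.GaloisRepresentations.AbsolutelyIrreducibleReduction
import Literature.RepresentationTheory.Semisimple.BurnsideMatrixSpan
import HarnessLib

/-!
# Crux `MuOrdinaryFamilyRT` (stmt-Langlands-13757), line `thorne-minimal-lift`: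
# stub `stub_pointGalois` — the Galois half of pointwise automorphy lifting (PROVED)

For generic `f`, a family `𝓕 : OrdFamily f ι e S₀ ρ_C`, a quadratic extension `F'/K` and an
`𝔪_R`-adically continuous, integral `ℚ̄₃`-point `y : 𝓕.R →+* ℚ̄₃`, the point representation
`ρ_y = y ∘ 𝓕.ρ` (`pointRep 𝓕 y`) IS a continuous framed representation `Γ_K →ₜ* GL₃(ℚ̄₃)`, and it is
absolutely irreducible on `Γ_{F'}`.

* `continuous_pointRep_val`, `continuous_pointRep` — automatic continuity: every entry
  `g ↦ y ((𝓕.ρ g)ᵢⱼ)` is continuous, because on the coset `g₀ · ker (𝓕.ρ mod 𝔪_R^M)` (open, by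
  `𝓕.continuous : Deformation.IsAdicContinuous 𝓕.ρ`) the entries of `𝓕.ρ g - 𝓕.ρ g₀ = 𝓕.ρ g₀ (𝓕.ρ (g₀⁻¹ g) - 1)`
  lie in `𝔪_R^M`, where `‖y ·‖ ≤ 3^{-N}`; continuity into `GL₃` (units topology) follows by
  `Units.continuous_iff` and continuity of inversion on `Γ_K`.
* `hasAbsolutelyIrreducibleReduction_pointRep` — the Burnside form
  `FramedRep.HasAbsolutelyIrreducibleReduction` in the identity frame: `ρ_y` is entrywise integral
  (`‖y r‖ ≤ 1`), and since the heart `r̄_f^B = 𝓕.ρ mod 𝔪_R` is absolutely irreducible for generic `f`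
  (tree `FreeSeedSmoothRt.rbarAbsIrreducible`) its image spans `M₃(𝔽₃)` (Burnside,
  `span_eq_top_iff_forall_isIrreducible`), so nine values `r̄(s_a)` form a basis of `M₃(𝔽₃)`; the `9 × 9`
  entry matrix `D` of the `𝓕.ρ (s_a)` then reduces under `𝓕.π` to an invertible matrix, so `det D ∉ ker π = 𝔪_R`
  is a unit of the local ring `R`, and `‖y (det D)‖ = 1` (both `y u`, `y u⁻¹` have norm `≤ 1`).
* `stub_pointGalois` — the registered stub: absolute irreducibility over `K` by
  `HasAbsolutelyIrreducibleReduction.isAbsolutelyIrreducible`, over `F'` by Clifford for odd rank `3` on the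
  index-`2` subgroup `Γ_{F'}` (`IsAbsolutelyIrreducible.restrictField_of_finrank_eq_two`).
-/

set_option linter.dupNamespace false

namespace Summit.Langlands.Langlands.Cruxes.MuOrdinaryFamilyRT.ThorneMinimalLift

open scoped NumberField Polynomial Matrix Classical
open Field IsDedekindDomain Polynomial
open Literature.NumberTheory.GaloisRepresentations Literature.NumberTheory.Automorphic
open Summit.Langlands.Langlands.Cruxes.MuOrdinaryFamilyRT.CharZeroDominance

noncomputable section

variable {f : ℤ[X]} {ι : PadicAlgCl 3 ≃+* ℂ} {e : K →+* ℂ} {S₀ : Finset (HeightOneSpectrum (𝓞 K))}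
  {ρC : FramedGaloisRep K (PadicAlgCl 3) 3}

/-! ## 1. Automatic continuity of the point representation -/

/-- Entries of the point representation: `(ρ_y g)ᵢⱼ = y ((𝓕.ρ g)ᵢⱼ)`. -/
theorem pointRep_val_apply (𝓕 : OrdFamily f ι e S₀ ρC) (y : 𝓕.R →+* PadicAlgCl 3)
    (g : absoluteGaloisGroup K) (i j : Fin 3) :
    (pointRep 𝓕 y g).val i j = y ((𝓕.ρ g).val i j) := rfl

/-- On the coset `g₀ · ker (𝓕.ρ mod I)` the entries of `𝓕.ρ g - 𝓕.ρ g₀` lie in `I`. -/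
theorem val_sub_val_mem (𝓕 : OrdFamily f ι e S₀ ρC) (I : Ideal 𝓕.R) {g₀ g : absoluteGaloisGroup K}
    (hg : ∀ i j, (𝓕.ρ (g₀⁻¹ * g)).val i j - (1 : Matrix (Fin 3) (Fin 3) 𝓕.R) i j ∈ I) (i j : Fin 3) :
    (𝓕.ρ g).val i j - (𝓕.ρ g₀).val i j ∈ I := by
  have key : (𝓕.ρ g).val - (𝓕.ρ g₀).val = (𝓕.ρ g₀).val * ((𝓕.ρ (g₀⁻¹ * g)).val - 1) := by
    rw [Matrix.mul_sub, Matrix.mul_one, ← Units.val_mul, ← map_mul, mul_inv_cancel_left]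
  have hij := congrArg (fun A : Matrix (Fin 3) (Fin 3) 𝓕.R => A i j) key
  simp only [Matrix.sub_apply] at hij
  rw [hij, Matrix.mul_apply]
  refine Ideal.sum_mem _ fun k _ => Ideal.mul_mem_left _ _ ?_
  exact hg k j

/-- **Automatic continuity of the entries.**  For an `𝔪_R`-adically continuous point `y` of the family, every
entry `g ↦ y ((𝓕.ρ g)ᵢⱼ)` of the point representation is continuous on `Γ_K`. -/
theorem continuous_pointRep_val (𝓕 : OrdFamily f ι e S₀ ρC) (y : 𝓕.R →+* PadicAlgCl 3)
    (hy : ∀ N : ℕ, ∃ M : ℕ, ∀ r ∈ IsLocalRing.maximalIdeal 𝓕.R ^ M, ‖y r‖ ≤ ((3 : ℝ)⁻¹) ^ N) :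
    Continuous fun g => (pointRep 𝓕 y g).val := by
  refine continuous_matrix fun i j => ?_
  refine continuous_iff_continuousAt.2 fun g₀ => ?_
  rw [ContinuousAt, Metric.tendsto_nhds]
  intro ε hε
  obtain ⟨N, hN⟩ : ∃ N : ℕ, ((3 : ℝ)⁻¹) ^ N < ε := exists_pow_lt_of_lt_one hε (by norm_num)
  obtain ⟨M, hM⟩ := hy N
  have hUo : IsOpen ((((Matrix.GeneralLinearGroup.map
      (Ideal.Quotient.mk (IsLocalRing.maximalIdeal 𝓕.R ^ M))).comp 𝓕.ρ).ker :
        Subgroup (absoluteGaloisGroup K)) : Set (absoluteGaloisGroup K)) := 𝓕.continuous M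
  have hnhds : (fun g => g₀⁻¹ * g) ⁻¹' ((((Matrix.GeneralLinearGroup.map
      (Ideal.Quotient.mk (IsLocalRing.maximalIdeal 𝓕.R ^ M))).comp 𝓕.ρ).ker :
        Subgroup (absoluteGaloisGroup K)) : Set (absoluteGaloisGroup K)) ∈ nhds g₀ := by
    refine (hUo.preimage (continuous_const_mul g₀⁻¹)).mem_nhds ?_
    rw [Set.mem_preimage, inv_mul_cancel, SetLike.mem_coe]
    exact Subgroup.one_mem _
  filter_upwards [hnhds] with g hg
  rw [Set.mem_preimage, SetLike.mem_coe, FreeSeedSmoothRt.mem_ker_map_mk_iff] at hg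
  rw [dist_eq_norm, pointRep_val_apply, pointRep_val_apply, ← map_sub]
  exact (hM _ (val_sub_val_mem 𝓕 _ hg i j)).trans_lt hN

/-- **Automatic continuity into `GL₃(ℚ̄₃)`** (units topology): the entries and the entries of the inverse
`(ρ_y g)⁻¹ = ρ_y (g⁻¹)` are continuous. -/
theorem continuous_pointRep (𝓕 : OrdFamily f ι e S₀ ρC) (y : 𝓕.R →+* PadicAlgCl 3)
    (hy : ∀ N : ℕ, ∃ M : ℕ, ∀ r ∈ IsLocalRing.maximalIdeal 𝓕.R ^ M, ‖y r‖ ≤ ((3 : ℝ)⁻¹) ^ N) :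
    Continuous (pointRep 𝓕 y) := by
  have hval := continuous_pointRep_val 𝓕 y hy
  refine Units.continuous_iff.2 ⟨hval, ?_⟩
  have heq : (fun g => (((pointRep 𝓕 y g)⁻¹ : GL (Fin 3) (PadicAlgCl 3)) :
      Matrix (Fin 3) (Fin 3) (PadicAlgCl 3))) =
      (fun g => ((pointRep 𝓕 y g : GL (Fin 3) (PadicAlgCl 3)) : Matrix (Fin 3) (Fin 3) (PadicAlgCl 3))) ∘
        fun g => g⁻¹ := by
    funext g
    simp only [Function.comp_apply, map_inv]
  rw [heq]
  exact hval.comp continuous_inv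

/-! ## 2. The Burnside form: absolutely irreducible reduction -/

/-- **Nine group elements whose residual images form a basis of `M₃(𝔽₃)`.**  For generic `f` the heart
`r̄_f^B` is absolutely irreducible (`FreeSeedSmoothRt.rbarAbsIrreducible`), so its image spans `M₃(𝔽₃)`
(Burnside), and a spanning family of the `9`-dimensional `M₃(𝔽₃)` contains a basis indexed by `3 × 3`; in
the flattened form: the `9 × 9` matrix of entries is invertible. -/
theorem exists_isUnit_entries_rbar (hgen : Generic f) (B : Module.Basis (Fin 3) (ZMod 3) (Heart 3 (Roots f))) :
    ∃ s : Fin 3 × Fin 3 → absoluteGaloisGroup K,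
      IsUnit (Matrix.of fun c d : Fin 3 × Fin 3 => (rbar f B (s c)).val d.1 d.2) := by
  have hirr : IsAbsIrreducible (rbar f B) := FreeSeedSmoothRt.rbarAbsIrreducible f B hgen
  have hspan : Submodule.span (ZMod 3) (Set.range fun g => (rbar f B g).val) = ⊤ :=
    (Literature.RepresentationTheory.Semisimple.span_eq_top_iff_forall_isIrreducible
      (by norm_num : 0 < 3) (rbar f B)).2 hirr
  obtain ⟨T, a, -, hspan', hli⟩ := exists_linearIndependent' (K := ZMod 3) fun g => (rbar f B g).val
  rw [hspan] at hspan'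
  let b : Module.Basis T (ZMod 3) (Matrix (Fin 3) (Fin 3) (ZMod 3)) := Module.Basis.mk hli hspan'.ge
  letI : Fintype T := FiniteDimensional.fintypeBasisIndex b
  have hcard : Fintype.card (Fin 3 × Fin 3) = Fintype.card T := by
    rw [← Module.finrank_eq_card_basis b, Module.finrank_matrix, Module.finrank_self, Fintype.card_prod]
    ring
  let ε : Fin 3 × Fin 3 ≃ T := Fintype.equivOfCardEq hcard
  have hli' : LinearIndependent (ZMod 3) (fun c => (rbar f B (a (ε c))).val) := hli.comp ε ε.injective
  refine ⟨fun c => a (ε c), (FramedRep.isUnit_of_entries_iff_span_eq_top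
    (fun c => (rbar f B (a (ε c))).val)).2 ?_⟩
  exact hli'.span_eq_top_of_card_eq_finrank' (hcard.trans (Module.finrank_eq_card_basis b).symm)

/-- In a local ring `R` with a surjection `π : R → 𝔽₃`, an element with non-zero image is a unit
(`ker π` is maximal, hence the maximal ideal). -/
theorem isUnit_of_map_ne_zero (𝓕 : OrdFamily f ι e S₀ ρC) {r : 𝓕.R} (hr : 𝓕.π r ≠ 0) : IsUnit r := by
  by_contra h
  have hmem : r ∈ IsLocalRing.maximalIdeal 𝓕.R := (IsLocalRing.mem_maximalIdeal _).mpr h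
  have hker : RingHom.ker 𝓕.π = IsLocalRing.maximalIdeal 𝓕.R :=
    IsLocalRing.eq_maximalIdeal (RingHom.ker_isMaximal_of_surjective 𝓕.π 𝓕.π_surjective)
  rw [← hker, RingHom.mem_ker] at hmem
  exact hr hmem

/-- An integral point maps units to elements of norm one (`‖y u‖ ≤ 1`, `‖y u⁻¹‖ ≤ 1`, product `1`). -/
theorem norm_map_unit_eq_one (𝓕 : OrdFamily f ι e S₀ ρC) (y : 𝓕.R →+* PadicAlgCl 3)
    (hy : ∀ r : 𝓕.R, ‖y r‖ ≤ 1) (u : 𝓕.Rˣ) : ‖y (u : 𝓕.R)‖ = 1 := by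
  refine le_antisymm (hy _) ?_
  have h1 : ‖y (u : 𝓕.R)‖ * ‖y (↑u⁻¹ : 𝓕.R)‖ = 1 := by
    rw [← norm_mul, ← map_mul, Units.mul_inv, map_one, norm_one]
  calc (1 : ℝ) = ‖y (u : 𝓕.R)‖ * ‖y (↑u⁻¹ : 𝓕.R)‖ := h1.symm
    _ ≤ ‖y (u : 𝓕.R)‖ * 1 := mul_le_mul_of_nonneg_left (hy _) (norm_nonneg _)
    _ = ‖y (u : 𝓕.R)‖ := mul_one _

/-- **Burnside form for the point representation.**  In the identity frame `ρ_y` is integral, and for nine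
elements `s_a ∈ Γ_K` whose reductions `r̄(s_a)` form a basis of `M₃(𝔽₃)` the entry matrix of the `𝓕.ρ (s_a)`
has unit determinant in `R` (`𝓕.residual`: it reduces under `𝓕.π` to the invertible entry matrix of the
`r̄(s_a)`; `ker π = 𝔪_R`), hence determinant of norm one under the integral point `y`. -/
theorem hasAbsolutelyIrreducibleReduction_pointRep (𝓕 : OrdFamily f ι e S₀ ρC) (hgen : Generic f)
    (y : 𝓕.R →+* PadicAlgCl 3) (hy : ∀ r : 𝓕.R, ‖y r‖ ≤ 1)
    (ρy : FramedGaloisRep K (PadicAlgCl 3) 3) (hρy : ∀ g, ρy g = pointRep 𝓕 y g) :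
    FramedRep.HasAbsolutelyIrreducibleReduction ρy := by
  obtain ⟨s, hunit⟩ := exists_isUnit_entries_rbar hgen 𝓕.B
  -- the entry matrix over `R` and its reduction
  obtain ⟨D, hD⟩ : ∃ D : Matrix (Fin 3 × Fin 3) (Fin 3 × Fin 3) 𝓕.R,
      D = Matrix.of fun c d : Fin 3 × Fin 3 => (𝓕.ρ (s c)).val d.1 d.2 := ⟨_, rfl⟩
  have hDmap : 𝓕.π.mapMatrix D = Matrix.of fun c d : Fin 3 × Fin 3 => (rbar f 𝓕.B (s c)).val d.1 d.2 := by
    ext c d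
    rw [AlgHom.mapMatrix_apply, Matrix.map_apply, hD, Matrix.of_apply, Matrix.of_apply]
    exact congrArg (fun A : Matrix (Fin 3) (Fin 3) (ZMod 3) => A d.1 d.2) (𝓕.residual (s c))
  have hπdet : 𝓕.π D.det ≠ 0 := by
    rw [AlgHom.map_det, hDmap]
    exact ((Matrix.isUnit_iff_isUnit_det _).1 hunit).ne_zero
  obtain ⟨u, hu⟩ := isUnit_of_map_ne_zero 𝓕 hπdet
  -- assemble the Burnside form in the identity frame
  refine ⟨1, s, fun σ i j => ?_, ?_⟩
  · rw [one_mul, inv_one, mul_one, hρy]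
    exact hy _
  · have hmat : (Matrix.of fun c d : Fin 3 × Fin 3 =>
        ((1 * ρy (s c) * 1⁻¹ : GL (Fin 3) (PadicAlgCl 3)) : Matrix (Fin 3) (Fin 3) (PadicAlgCl 3)) d.1 d.2) =
        y.mapMatrix D := by
      ext c d
      rw [Matrix.of_apply, one_mul, inv_one, mul_one, hρy, RingHom.mapMatrix_apply, Matrix.map_apply, hD,
        Matrix.of_apply]
      rfl
    rw [hmat, ← RingHom.map_det, ← hu]
    exact norm_map_unit_eq_one 𝓕 y hy u

/-! ## 3. The registered stub -/

/-- **`stub_pointGalois` — the Galois half of pointwise lifting (PROVED).**  For generic `f`, a family `𝓕`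
through `ρ_C`, a quadratic extension `F'/K` and an `𝔪_R`-adically continuous, integral `ℚ̄₃`-point `y` of
`𝓕.R`, the point representation `ρ_y = y ∘ 𝓕.ρ` (`pointRep`) IS a continuous framed representation
`Γ_K → GL₃(ℚ̄₃)` (`continuous_pointRep`: automatic continuity from `𝓕.continuous`), and it is absolutely
irreducible on `Γ_{F'}`: its reduction in the identity frame is the absolutely irreducible heart `r̄_f^B`
(`hasAbsolutelyIrreducibleReduction_pointRep`, Burnside form), so `ρ_y` is absolutely irreducible
(`HasAbsolutelyIrreducibleReduction.isAbsolutelyIrreducible`), hence so is `ρ_y|Γ_{F'}` (rank `3` odd,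
`[Γ_K : Γ_{F'}] = 2`: `IsAbsolutelyIrreducible.restrictField_of_finrank_eq_two`, Clifford). -/
theorem stub_pointGalois :
    ∀ (f : ℤ[X]) (ι : PadicAlgCl 3 ≃+* ℂ) (e : K →+* ℂ) (S₀ : Finset (HeightOneSpectrum (𝓞 K)))
      (ρC : FramedGaloisRep K (PadicAlgCl 3) 3) (𝓕 : OrdFamily f ι e S₀ ρC), Generic f →
    ∀ (F' : Type) [Field F'] [Algebra K F'], Module.finrank K F' = 2 →
    ∀ y : 𝓕.R →+* PadicAlgCl 3,
      (∀ N : ℕ, ∃ M : ℕ, ∀ r ∈ IsLocalRing.maximalIdeal 𝓕.R ^ M, ‖y r‖ ≤ ((3 : ℝ)⁻¹) ^ N) →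
      (∀ r : 𝓕.R, ‖y r‖ ≤ 1) →
      ∃ ρy : FramedGaloisRep K (PadicAlgCl 3) 3,
        (∀ g, ρy g = pointRep 𝓕 y g) ∧ FramedRep.IsAbsolutelyIrreducible (ρy.restrictField F') := by
  intro f ι e S₀ ρC 𝓕 hgen F' _ _ hdeg y hy₁ hy₂
  -- the point representation, framed: automatic continuity
  let ρy : FramedGaloisRep K (PadicAlgCl 3) 3 :=
    { toMonoidHom := pointRep 𝓕 y, continuous_toFun := continuous_pointRep 𝓕 y hy₁ }
  have hρy : ∀ g, ρy g = pointRep 𝓕 y g := fun _ => rfl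
  refine ⟨ρy, hρy, ?_⟩
  have habs : FramedRep.IsAbsolutelyIrreducible ρy :=
    FramedRep.HasAbsolutelyIrreducibleReduction.isAbsolutelyIrreducible (by norm_num : 0 < 3)
      (hasAbsolutelyIrreducibleReduction_pointRep 𝓕 hgen y hy₂ ρy hρy)
  exact FramedGaloisRep.IsAbsolutelyIrreducible.restrictField_of_finrank_eq_two ⟨1, rfl⟩ F' hdeg habs

end

end Summit.Langlands.Langlands.Cruxes.MuOrdinaryFamilyRT.ThorneMinimalLift
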